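import Literature.Computability.AlgebraicComplexity.IsotypicCommutantSpan
import Literature.Computability.AlgebraicComplexity.QuantumFunctionalsUpperSupportProofs
import Literature.Computability.AlgebraicComplexity.QuantumFunctionalsUpperBridge
import Literature.Computability.AlgebraicComplexity.QuantumFunctionalsUpperProofs
import Literature.Computability.AlgebraicComplexity.QuantumFunctionalsUpperMonotone
import Literature.Computability.AlgebraicComplexity.QuantumFunctionalsUpperKroneckerProofs
import Literature.Computability.AlgebraicComplexity.QuantumFunctionalsRestrictionProofs
import HarnessLib

/-!
# The upper quantum functional dominates the lower one: `E_θ(t) ≤ E^θ(t)` (CVZ Thm. 3.24)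

Topic `Literature/Computability/AlgebraicComplexity`; proofs file (theorems only) for
M. Christandl, P. Vrana, J. Zuiddam, *Universal points in the asymptotic spectrum of tensors*,
J. Amer. Math. Soc. 36 (2023) 31–79 = arXiv:1709.07851v3, **Theorem 3.24**: for `θ ∈ P([3])` (the
`k = 3` case, in which every `θ ∈ P(B)` is supported on singletons) and every complex 3-tensor `t`,
`E^θ(t) ≥ E_θ(t)`, where `E^θ = upperLogQuantumFunctional θ` is the upper functional of Def. 3.3
(`QuantumFunctionalsUpper.lean`: a supremum of `θ`-weighted entropies `∑ θⱼ H(λ̄⁽ʲ⁾)` over the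
*admissible* triples of Young diagrams, `(P_{λ⁽¹⁾} ⊗ P_{λ⁽²⁾} ⊗ P_{λ⁽³⁾}) t^{⊗n} ≠ 0`) and
`E_θ = logQuantumFunctional θ` is the lower functional of Def. 3.16 (`QuantumFunctionals.lean`: the
supremum over `GL × GL × GL` of the `θ`-weighted marginal von Neumann entropies). This is one of the
two inequalities of Thm. 3.30 (`E^θ = E_θ`, the named fact
`ChristandlVranaZuiddam2023_upper_eq_lower`), on which the additivity and multiplicativity of the
quantum functionals (Cor. 3.31; facts `…_directSum`, `…_kronecker`) rest.

## The printed proof and the proof given here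

CVZ derive Thm. 3.24 from Keyl–Werner spectrum estimation (Thm. 3.27 / Cor. 3.28:
`tr P_λ ρ^{⊗n} ≤ poly(n) exp(-n D(λ̄ ‖ r))`) and the gentle measurement lemma (Lemma 3.25 /
Cor. 3.26). The proof below has the same architecture — for `ψ = g·t/‖g·t‖` with marginal spectra
`r⁽ʲ⁾`, most of `ψ^{⊗n}` sits in isotypic components `P_{λ⁽¹⁾} ⊗ P_{λ⁽²⁾} ⊗ P_{λ⁽³⁾}` with
`H(λ̄⁽ʲ⁾) ≥ H(r⁽ʲ⁾) - ε`, so one such triple is admissible — but replaces the two analytic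
ingredients by elementary ones already in the tree:

* **one-sided spectrum estimation** (`trace_subproj_powMat_le`): for every `δ > 0` and all large
  `n`, `re tr(Q ρ^{⊗n}) ≤ δ (tr ρ)^n` for every Hermitian idempotent `Q` whose range lies in the
  commutant span `𝒲(L_n)` of the words of empirical entropy `≤ H(spec ρ) - ε` — the sibling estimate
  `trace_proj_powMat_le` (`SpectrumSupportEstimate.lean`, for the projection ONTO `𝒲(L_n)`) plus
  the monotonicity `re tr(Q M) ≤ re tr(P M)` for `Q ≤ P`, `M ≥ 0` (`re_trace_mul_le_of_range_le`).
  By `IsotypicCommutantSpan.lean` this applies to `Q = ∑_{H(λ̄) ≤ H(r) - ε} P_λ`.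
* **a three-leg union bound** in place of the gentle measurement lemma
  (`tensorNormSq_le_sum_three_legs`, `KroneckerPowMarginals.lean`): if no triple with all three
  entropies `> H(r⁽ʲ⁾) - ε` were admissible, `ψ^{⊗n}` would be the sum of three pieces each fixed by
  a low-entropy projection on one leg, forcing `1 ≤ 3/4`.

Main results:

* `exists_upperAdmissible_fin`, `exists_upperAdmissible` — for `x ≠ 0` and `ε > 0` there is an
  admissible triple `(λ⁽ʲ⁾ ⊢ n)ⱼ` for `x` with `∑ θⱼ H(λ̄⁽ʲ⁾) ≥ H_θ(x) - ε` (first on alphabets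
  `Fin a`, where the representation theory lives, then on arbitrary finite index types by
  re-indexing, `reindexPow`);
* `quantumEntropy_le_upperLogQuantumFunctional` — `H_θ(x) ≤ E^θ(x)`;
* `logQuantumFunctional_le_upperLogQuantumFunctional` — **Thm. 3.24**: `E_θ(t) ≤ E^θ(t)`
  (with the `GL`-invariance of `E^θ`, `upperLogQuantumFunctional_actTensor_le`, CVZ Lemma 3.6).

No definitions, no named facts. The converse inequality `E^θ ≤ E_θ` (Thm. 3.30 via the
entanglement polytope, Thm. 3.29) is not treated here.

## References

* M. Christandl, P. Vrana, J. Zuiddam, J. Amer. Math. Soc. 36 (2023) 31–79 = arXiv:1709.07851v3,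
  Def. 3.3, Def. 3.15–3.16, Lemma 3.6, §3.3 (Thm. 3.24, Lemma 3.25, Cor. 3.26, Thm. 3.27, Cor. 3.28),
  Thm. 3.30. [ChristandlVranaZuiddam2023]
* M. Keyl, R. F. Werner, *Estimating the spectrum of a density operator*, Phys. Rev. A 64 (2001)
  052311 (the spectrum estimation theorem, cited as [KW01] in the source).
-/

noncomputable section

open scoped BigOperators Matrix ComplexOrder

namespace Literature.Computability.AlgebraicComplexity

open Literature.NumberTheory.DiophantineGeometry (Word spechtCharacter)
open Literature.RepresentationTheory.FiniteGroups (wordIsotypicMatrix)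

/-! ## Monotonicity of `re tr(Q M)` in the projection `Q` -/

section SubProj

variable {X : Type*} [Fintype X] [DecidableEq X]

/-- If `P` fixes `W` pointwise and `Q` maps into `W` then `P Q = Q`. [folklore] -/
theorem proj_mul_eq_of_range_le {W : Submodule ℂ (X → ℂ)} {P Q : Matrix X X ℂ}
    (hPfix : ∀ w ∈ W, P *ᵥ w = w) (hQinto : ∀ v, Q *ᵥ v ∈ W) : P * Q = Q := by
  refine Matrix.toLin'.injective (LinearMap.ext fun v => ?_)
  simp only [Matrix.toLin'_apply, ← Matrix.mulVec_mulVec]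
  exact hPfix _ (hQinto v)

/-- **Monotonicity of expectation values in the projection**: for the Hermitian projection `P` onto a
subspace `W`, a Hermitian idempotent `Q` with range in `W`, and a positive semidefinite `M`,
`re tr(Q M) ≤ re tr(P M)` (`P - Q` is again a Hermitian idempotent and
`tr((P - Q) M) = tr((P - Q) M (P - Q)ᴴ) ≥ 0`). [folklore] -/
theorem re_trace_mul_le_of_range_le {W : Submodule ℂ (X → ℂ)} {P Q M : Matrix X X ℂ}
    (hP : P.IsHermitian) (hPfix : ∀ w ∈ W, P *ᵥ w = w) (hPinto : ∀ v, P *ᵥ v ∈ W)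
    (hQ : Q.IsHermitian) (hQQ : Q * Q = Q) (hQinto : ∀ v, Q *ᵥ v ∈ W) (hM : M.PosSemidef) :
    (Q * M).trace.re ≤ (P * M).trace.re := by
  have hPQ : P * Q = Q := proj_mul_eq_of_range_le hPfix hQinto
  have hQP : Q * P = Q := by
    have h := congrArg Matrix.conjTranspose hPQ
    rwa [Matrix.conjTranspose_mul, hP.eq, hQ.eq] at h
  have hPP : P * P = P := mul_self_of_proj hPfix hPinto
  set D := P - Q with hD
  have hDh : Dᴴ = D := by rw [hD, Matrix.conjTranspose_sub, hP.eq, hQ.eq]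
  have hDD : D * D = D := by
    rw [hD, Matrix.sub_mul, Matrix.mul_sub, Matrix.mul_sub, hPP, hPQ, hQP, hQQ, sub_self, sub_zero]
  have hsplit : (P * M).trace = (Q * M).trace + (D * M).trace := by
    rw [hD, Matrix.sub_mul, Matrix.trace_sub]
    ring
  have hDM : (D * M).trace = (D * M * Dᴴ).trace := by
    calc (D * M).trace = (D * D * M).trace := by rw [hDD]
      _ = (D * (D * M)).trace := by rw [Matrix.mul_assoc]
      _ = (D * M * D).trace := Matrix.trace_mul_comm _ _
      _ = (D * M * Dᴴ).trace := by rw [hDh]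
  have hpsd : (D * M * Dᴴ).PosSemidef := hM.mul_mul_conjTranspose_same D
  have hnn : 0 ≤ (D * M * Dᴴ).trace.re := (Complex.nonneg_iff.1 hpsd.trace_nonneg).1
  rw [hsplit, Complex.add_re, hDM]
  linarith

end SubProj

/-! ## One-sided spectrum estimation for sub-projections of the low-entropy commutant span -/

section Estimate

variable {ι ι' : Type*} [Fintype ι] [Fintype ι'] [DecidableEq ι] [DecidableEq ι']

/-- The Kronecker power of a positive semidefinite matrix is positive semidefinite
(`(RᴴR)^{⊗n} = (R^{⊗n})ᴴ R^{⊗n}`). [folklore] -/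
theorem posSemidef_powMat {ρ : Matrix ι ι ℂ} (hρ : ρ.PosSemidef) (n : ℕ) : (powMat ρ n).PosSemidef := by
  obtain ⟨R, V, hR, -⟩ := exists_gram_sqrt_path hρ
  rw [← hR, powMat_mul, powMat_conjTranspose]
  exact Matrix.posSemidef_conjTranspose_mul_self _

/-- **One-sided spectrum estimation** (elementary substitute for CVZ Thm. 3.27 / Cor. 3.28): for a
positive semidefinite `ρ` with eigenvalues `N rᵢ` (`r` a probability vector, `H(r) = c`, `N > 0`),
`ε > 0`, sets `L n` of words with `|L n| ≤ (n+1)^{|ι|} e^{(n log 2)(c-ε)}`, and `δ > 0`: for all large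
`n`, every Hermitian idempotent `Q` WITH RANGE INSIDE `𝒲(L n)` has `re tr(Q ρ^{⊗n}) ≤ δ N^n`. (The
sibling `trace_proj_powMat_le` is the case of the projection onto `𝒲(L n)`; the general case follows by
`re_trace_mul_le_of_range_le`.) [cite: ChristandlVranaZuiddam2023, Thm. 3.27] -/
theorem trace_subproj_powMat_le {ρ : Matrix ι' ι' ℂ} (hρ : ρ.PosSemidef) (hρh : ρ.IsHermitian)
    {N : ℝ} (hN : 0 < N) {r : ι' → ℝ} (hr : r ∈ stdSimplex ℝ ι')
    (hev : ∀ i, hρh.eigenvalues i = N * r i) {c ε : ℝ} (hc : shannonEntropy r = c) (hε : 0 < ε)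
    (L : ∀ n : ℕ, Finset (Fin n → ι))
    (hL : ∀ n : ℕ, 0 < n →
      ((L n).card : ℝ) ≤ ((n : ℝ) + 1) ^ Fintype.card ι * Real.exp (n * Real.log 2 * (c - ε)))
    {δ : ℝ} (hδ : 0 < δ) :
    ∃ n₀ : ℕ, ∀ n : ℕ, n₀ ≤ n → ∀ Q : Matrix (Fin n → ι') (Fin n → ι') ℂ, Q.IsHermitian →
      Q * Q = Q → (∀ v, Q *ᵥ v ∈ commutantSpan ι' (L n)) →
      (Q * powMat ρ n).trace.re ≤ δ * N ^ n := by
  obtain ⟨n₀, hn₀⟩ := trace_proj_powMat_le hρh hN hr hev hc hε L hL hδ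
  refine ⟨n₀, fun n hn Q hQ hQQ hQinto => ?_⟩
  obtain ⟨k, B, -, hB, hcol, hfix⟩ := exists_orthonormalFrame (commutantSpan ι' (L n))
  have hPh : (B * Bᴴ).IsHermitian := Matrix.isHermitian_mul_conjTranspose_self B
  have hPinto : ∀ f, (B * Bᴴ) *ᵥ f ∈ commutantSpan ι' (L n) := frame_proj_mulVec_mem hcol
  have hP := hn₀ n hn (B * Bᴴ) hPh hfix hPinto
  exact (re_trace_mul_le_of_range_le hPh hfix hPinto hQ hQQ hQinto (posSemidef_powMat hρ n)).trans hP

end Estimate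

/-! ## The action in the matrix arguments: sums; the operator of Def. 3.3 as an action -/

section ActSums

variable {K : Type*} [CommRing K] {ι κ μ ι' κ' μ' : Type*} [Fintype ι] [Fintype κ] [Fintype μ]

/-- `(0 ⊗ B ⊗ C)·t = 0`. [folklore] -/
theorem actTensor_zero_fst (B : Matrix κ' κ K) (C : Matrix μ' μ K) (t : ι → κ → μ → K) :
    actTensor (0 : Matrix ι' ι K) B C t = 0 := by
  funext a b c; simp [actTensor_apply]

/-- `(A ⊗ 0 ⊗ C)·t = 0`. [folklore] -/
theorem actTensor_zero_snd (A : Matrix ι' ι K) (C : Matrix μ' μ K) (t : ι → κ → μ → K) :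
    actTensor A (0 : Matrix κ' κ K) C t = 0 := by
  funext a b c; simp [actTensor_apply]

/-- `(A ⊗ B ⊗ 0)·t = 0`. [folklore] -/
theorem actTensor_zero_thd (A : Matrix ι' ι K) (B : Matrix κ' κ K) (t : ι → κ → μ → K) :
    actTensor A B (0 : Matrix μ' μ K) t = 0 := by
  funext a b c; simp [actTensor_apply]

/-- The action is additive in the first matrix over finite sums. [folklore] -/
theorem actTensor_sum_fst {α : Type*} (s : Finset α) (A : α → Matrix ι' ι K) (B : Matrix κ' κ K)
    (C : Matrix μ' μ K) (t : ι → κ → μ → K) :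
    actTensor (∑ x ∈ s, A x) B C t = ∑ x ∈ s, actTensor (A x) B C t := by
  classical
  induction s using Finset.induction_on with
  | empty => rw [Finset.sum_empty, Finset.sum_empty, actTensor_zero_fst]
  | insert x s hx ih => rw [Finset.sum_insert hx, Finset.sum_insert hx, actTensor_add_fst, ih]

/-- The action is additive in the second matrix over finite sums. [folklore] -/
theorem actTensor_sum_snd {α : Type*} (s : Finset α) (A : Matrix ι' ι K) (B : α → Matrix κ' κ K)
    (C : Matrix μ' μ K) (t : ι → κ → μ → K) :
    actTensor A (∑ x ∈ s, B x) C t = ∑ x ∈ s, actTensor A (B x) C t := by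
  classical
  induction s using Finset.induction_on with
  | empty => rw [Finset.sum_empty, Finset.sum_empty, actTensor_zero_snd]
  | insert x s hx ih => rw [Finset.sum_insert hx, Finset.sum_insert hx, actTensor_add_snd, ih]

/-- The action is additive in the third matrix over finite sums. [folklore] -/
theorem actTensor_sum_thd {α : Type*} (s : Finset α) (A : Matrix ι' ι K) (B : Matrix κ' κ K)
    (C : α → Matrix μ' μ K) (t : ι → κ → μ → K) :
    actTensor A B (∑ x ∈ s, C x) t = ∑ x ∈ s, actTensor A B (C x) t := by
  classical
  induction s using Finset.induction_on with
  | empty => rw [Finset.sum_empty, Finset.sum_empty, actTensor_zero_thd]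
  | insert x s hx ih => rw [Finset.sum_insert hx, Finset.sum_insert hx, actTensor_add_thd, ih]

/-- The action is homogeneous in the tensor. [folklore] -/
theorem actTensor_tensor_smul (A : Matrix ι' ι K) (B : Matrix κ' κ K) (C : Matrix μ' μ K) (z : K)
    (t : ι → κ → μ → K) : actTensor A B C (z • t) = z • actTensor A B C t := by
  funext a b c
  simp only [actTensor_apply, Pi.smul_apply, smul_eq_mul, Finset.mul_sum]
  exact Finset.sum_congr rfl fun _ _ => Finset.sum_congr rfl fun _ _ =>
    Finset.sum_congr rfl fun _ _ => by ring

end ActSums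

section Bridge

variable {N n : ℕ} {κ' μ' : Type*} [Fintype κ'] [Fintype μ'] [DecidableEq κ'] [DecidableEq μ']

/-- `isotypicSum₁ λ u = (n!/χ_λ(1)) • (P_λ ⊗ 1 ⊗ 1)·u` on the alphabet `Fin N` (inverse form of
`actTensor_wordIsotypicMatrix_fst`). [cite: ChristandlVranaZuiddam2023, §3.1] -/
theorem isotypicSum₁_eq_smul_actTensor (lam : Nat.Partition n)
    (u : Word N n → (Fin n → κ') → (Fin n → μ') → ℂ) :
    isotypicSum₁ lam u = (spechtCharacter ℂ lam 1 / Fintype.card (Equiv.Perm (Fin n)))⁻¹ •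
      actTensor (wordIsotypicMatrix N n lam) (1 : Matrix (Fin n → κ') (Fin n → κ') ℂ)
        (1 : Matrix (Fin n → μ') (Fin n → μ') ℂ) u := by
  rw [actTensor_wordIsotypicMatrix_fst, smul_smul,
    inv_mul_cancel₀ (spechtCharacter_one_div_card_ne_zero lam), one_smul]

/-- `isotypicSum₂ λ u = (n!/χ_λ(1)) • (1 ⊗ P_λ ⊗ 1)·u`. [cite: ChristandlVranaZuiddam2023, §3.1] -/
theorem isotypicSum₂_eq_smul_actTensor (lam : Nat.Partition n)
    (u : (Fin n → κ') → Word N n → (Fin n → μ') → ℂ) :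
    isotypicSum₂ lam u = (spechtCharacter ℂ lam 1 / Fintype.card (Equiv.Perm (Fin n)))⁻¹ •
      actTensor (1 : Matrix (Fin n → κ') (Fin n → κ') ℂ) (wordIsotypicMatrix N n lam)
        (1 : Matrix (Fin n → μ') (Fin n → μ') ℂ) u := by
  rw [actTensor_wordIsotypicMatrix_snd, smul_smul,
    inv_mul_cancel₀ (spechtCharacter_one_div_card_ne_zero lam), one_smul]

/-- `isotypicSum₃ λ u = (n!/χ_λ(1)) • (1 ⊗ 1 ⊗ P_λ)·u`. [cite: ChristandlVranaZuiddam2023, §3.1] -/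
theorem isotypicSum₃_eq_smul_actTensor (lam : Nat.Partition n)
    (u : (Fin n → κ') → (Fin n → μ') → Word N n → ℂ) :
    isotypicSum₃ lam u = (spechtCharacter ℂ lam 1 / Fintype.card (Equiv.Perm (Fin n)))⁻¹ •
      actTensor (1 : Matrix (Fin n → κ') (Fin n → κ') ℂ) (1 : Matrix (Fin n → μ') (Fin n → μ') ℂ)
        (wordIsotypicMatrix N n lam) u := by
  rw [actTensor_wordIsotypicMatrix_thd, smul_smul,
    inv_mul_cancel₀ (spechtCharacter_one_div_card_ne_zero lam), one_smul]

end Bridge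

section Admissible

variable {a b c n : ℕ}

/-- **The operator of Def. 3.3 is a nonzero multiple of an action**: on alphabets `Fin a, Fin b, Fin c`,
`upperProjection θ λ u = κ • (M₁ ⊗ M₂ ⊗ M₃)·u` with `κ ≠ 0` and `Mⱼ = P_{λ⁽ʲ⁾}` for `θⱼ ≠ 0`,
`Mⱼ = 1` for `θⱼ = 0`. [cite: ChristandlVranaZuiddam2023, Def. 3.3] -/
theorem upperProjection_eq_smul_actTensor (θ : Fin 3 → ℝ) (lam : Fin 3 → Nat.Partition n)
    (u : Word a n → Word b n → Word c n → ℂ) :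
    ∃ z : ℂ, z ≠ 0 ∧ upperProjection θ lam u = z • actTensor
      (if θ 0 = 0 then 1 else wordIsotypicMatrix a n (lam 0))
      (if θ 1 = 0 then 1 else wordIsotypicMatrix b n (lam 1))
      (if θ 2 = 0 then 1 else wordIsotypicMatrix c n (lam 2)) u := by
  classical
  set d : Fin 3 → ℂ := fun j => (spechtCharacter ℂ (lam j) 1 / Fintype.card (Equiv.Perm (Fin n)))⁻¹
    with hd
  have hd0 : ∀ j, d j ≠ 0 := fun j => inv_ne_zero (spechtCharacter_one_div_card_ne_zero (lam j))
  refine ⟨(if θ 0 = 0 then 1 else d 0) * ((if θ 1 = 0 then 1 else d 1) * (if θ 2 = 0 then 1 else d 2)),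
    ?_, ?_⟩
  · refine mul_ne_zero ?_ (mul_ne_zero ?_ ?_) <;> split_ifs
    exacts [one_ne_zero, hd0 0, one_ne_zero, hd0 1, one_ne_zero, hd0 2]
  · simp only [upperProjection]
    split_ifs <;>
      simp only [isotypicSum₁_eq_smul_actTensor, isotypicSum₂_eq_smul_actTensor,
        isotypicSum₃_eq_smul_actTensor, actTensor_tensor_smul, actTensor_actTensor, smul_smul,
        one_mul, mul_one, actTensor_one, one_smul, hd]

/-- **Admissibility from the isotypic projectors**: if `(P_{λ⁽¹⁾} ⊗ P_{λ⁽²⁾} ⊗ P_{λ⁽³⁾}) x^{⊗n} ≠ 0`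
then the triple is admissible for `x` in the sense of Def. 3.3 (for every `θ`; legs with `θⱼ = 0`
carry no constraint). [cite: ChristandlVranaZuiddam2023, Def. 3.3] -/
theorem upperAdmissible_of_actTensor_wordIsotypicMatrix_ne_zero (θ : Fin 3 → ℝ)
    {x : Fin a → Fin b → Fin c → ℂ} {lam : Fin 3 → Nat.Partition n}
    (h : actTensor (wordIsotypicMatrix a n (lam 0)) (wordIsotypicMatrix b n (lam 1))
      (wordIsotypicMatrix c n (lam 2)) (kroneckerPow x n) ≠ 0) :
    UpperAdmissible θ x n lam := by
  classical
  obtain ⟨z, hz, heq⟩ := upperProjection_eq_smul_actTensor θ lam (kroneckerPow x n)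
  intro h0
  apply h
  rw [heq, smul_eq_zero] at h0
  have h0' := h0.resolve_left hz
  have key : actTensor (wordIsotypicMatrix a n (lam 0)) (wordIsotypicMatrix b n (lam 1))
      (wordIsotypicMatrix c n (lam 2)) (kroneckerPow x n) =
      actTensor (if θ 0 = 0 then wordIsotypicMatrix a n (lam 0) else 1)
        (if θ 1 = 0 then wordIsotypicMatrix b n (lam 1) else 1)
        (if θ 2 = 0 then wordIsotypicMatrix c n (lam 2) else 1)
        (actTensor (if θ 0 = 0 then 1 else wordIsotypicMatrix a n (lam 0))
          (if θ 1 = 0 then 1 else wordIsotypicMatrix b n (lam 1))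
          (if θ 2 = 0 then 1 else wordIsotypicMatrix c n (lam 2)) (kroneckerPow x n)) := by
    rw [actTensor_actTensor]
    congr 1 <;> split_ifs <;> simp only [Matrix.mul_one, Matrix.one_mul]
  rw [key, h0', actTensor_zero]

end Admissible

/-! ## The core: an admissible triple of entropy at least `H_θ(x) - ε` -/

section Core

/-- **Core of Thm. 3.24 (alphabets `Fin a`).** For a nonzero 3-tensor `x`, `θ ∈ P([3])` and `ε > 0`
there are `n ≥ 1` and a triple `(λ⁽ʲ⁾ ⊢ n)ⱼ`, admissible for `x` (Def. 3.3), with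
`∑ⱼ θⱼ H(λ̄⁽ʲ⁾) ≥ H_θ(x) - ε`. Proof: with `Qⱼ = ∑_{H(λ̄) ≤ H(rⱼ) - ε} P_λ` on leg `j` (range in the
low-entropy commutant span, `IsotypicCommutantSpan.lean`) the one-sided spectrum estimate gives
`re tr(Qⱼ ρⱼ^{⊗n}) ≤ ‖x‖^{2n}/4` for large `n`; if `((1-Q₁) ⊗ (1-Q₂) ⊗ (1-Q₃)) x^{⊗n}` vanished, the
three-leg union bound would give `‖x‖^{2n} ≤ (3/4)‖x‖^{2n}`; so some triple outside the low sets has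
`(P ⊗ P ⊗ P) x^{⊗n} ≠ 0`. [cite: ChristandlVranaZuiddam2023, Thm. 3.24] -/
theorem exists_upperAdmissible_fin {a b c : ℕ} {θ : Fin 3 → ℝ} (hθ : θ ∈ stdSimplex ℝ (Fin 3))
    {x : Fin a → Fin b → Fin c → ℂ} (hx : x ≠ 0) {ε : ℝ} (hε : 0 < ε) :
    ∃ (n : ℕ) (lam : Fin 3 → Nat.Partition n), 0 < n ∧ UpperAdmissible θ x n lam ∧
      quantumEntropy θ x - ε ≤ weightedPartitionEntropy θ lam := by
  classical
  -- the marginal data of `x`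
  set N := tensorNormSq x with hNdef
  have hN : 0 < N := tensorNormSq_pos hx
  set r₁ := marginalSpectrum₁ x with hr₁def
  set r₂ := marginalSpectrum₂ x with hr₂def
  set r₃ := marginalSpectrum₃ x with hr₃def
  set c₁ := shannonEntropy r₁ with hc₁
  set c₂ := shannonEntropy r₂ with hc₂
  set c₃ := shannonEntropy r₃ with hc₃
  have hq : quantumEntropy θ x = θ 0 * c₁ + θ 1 * c₂ + θ 2 * c₃ := rfl
  have hr₁ : r₁ ∈ stdSimplex ℝ (Fin a) := marginalSpectrum₁_mem_stdSimplex hx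
  have hr₂ : r₂ ∈ stdSimplex ℝ (Fin b) := marginalSpectrum₂_mem_stdSimplex hx
  have hr₃ : r₃ ∈ stdSimplex ℝ (Fin c) := marginalSpectrum₃_mem_stdSimplex hx
  have hev₁ := eigenvalues_eq_tensorNormSq_mul_marginalSpectrum₁ hx
  have hev₂ := eigenvalues_eq_tensorNormSq_mul_marginalSpectrum₂ hx
  have hev₃ := eigenvalues_eq_tensorNormSq_mul_marginalSpectrum₃ hx
  -- the low sets of words on the three legs
  set L₁ : ∀ n : ℕ, Finset (Fin n → Fin a) := fun n => Finset.univ.filter fun u =>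
    shannonEntropy (fun i => (letterCount u i : ℝ) / n) ≤ c₁ - ε with hL₁
  set L₂ : ∀ n : ℕ, Finset (Fin n → Fin b) := fun n => Finset.univ.filter fun v =>
    shannonEntropy (fun i => (letterCount v i : ℝ) / n) ≤ c₂ - ε with hL₂
  set L₃ : ∀ n : ℕ, Finset (Fin n → Fin c) := fun n => Finset.univ.filter fun w =>
    shannonEntropy (fun i => (letterCount w i : ℝ) / n) ≤ c₃ - ε with hL₃
  have hL₁c : ∀ n : ℕ, 0 < n → ((L₁ n).card : ℝ) ≤
      ((n : ℝ) + 1) ^ Fintype.card (Fin a) * Real.exp (n * Real.log 2 * (c₁ - ε)) :=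
    fun n hn => card_filter_entropy_le hn _
  have hL₂c : ∀ n : ℕ, 0 < n → ((L₂ n).card : ℝ) ≤
      ((n : ℝ) + 1) ^ Fintype.card (Fin b) * Real.exp (n * Real.log 2 * (c₂ - ε)) :=
    fun n hn => card_filter_entropy_le hn _
  have hL₃c : ∀ n : ℕ, 0 < n → ((L₃ n).card : ℝ) ≤
      ((n : ℝ) + 1) ^ Fintype.card (Fin c) * Real.exp (n * Real.log 2 * (c₃ - ε)) :=
    fun n hn => card_filter_entropy_le hn _
  -- one-sided spectrum estimation on each leg with `δ = 1/4`
  have hδ : (0 : ℝ) < 1 / 4 := by norm_num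
  obtain ⟨n₁, hn₁⟩ := trace_subproj_powMat_le (posSemidef_reducedDensity₁ x)
    (isHermitian_reducedDensity₁ x) hN hr₁ hev₁ hc₁.symm hε L₁ hL₁c hδ
  obtain ⟨n₂, hn₂⟩ := trace_subproj_powMat_le (posSemidef_reducedDensity₂ x)
    (isHermitian_reducedDensity₂ x) hN hr₂ hev₂ hc₂.symm hε L₂ hL₂c hδ
  obtain ⟨n₃, hn₃⟩ := trace_subproj_powMat_le (posSemidef_reducedDensity₃ x)
    (isHermitian_reducedDensity₃ x) hN hr₃ hev₃ hc₃.symm hε L₃ hL₃c hδ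
  -- a large `n`
  set n := max (max n₁ n₂) (max n₃ 1) with hndef
  have hnn₁ : n₁ ≤ n := le_trans (le_max_left _ _) (le_max_left _ _)
  have hnn₂ : n₂ ≤ n := le_trans (le_max_right _ _) (le_max_left _ _)
  have hnn₃ : n₃ ≤ n := le_trans (le_max_left _ _) (le_max_right _ _)
  have hnpos : 0 < n := lt_of_lt_of_le Nat.one_pos (le_trans (le_max_right _ _) (le_max_right _ _))
  -- the low sets of shapes and the corresponding sums of isotypic projectors
  set B₁ : Finset (Nat.Partition n) := Finset.univ.filter fun lam => partitionEntropy lam ≤ c₁ - ε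
    with hB₁
  set B₂ : Finset (Nat.Partition n) := Finset.univ.filter fun lam => partitionEntropy lam ≤ c₂ - ε
    with hB₂
  set B₃ : Finset (Nat.Partition n) := Finset.univ.filter fun lam => partitionEntropy lam ≤ c₃ - ε
    with hB₃
  set Q₁ : Matrix (Word a n) (Word a n) ℂ := ∑ lam ∈ B₁, wordIsotypicMatrix a n lam with hQ₁
  set Q₂ : Matrix (Word b n) (Word b n) ℂ := ∑ lam ∈ B₂, wordIsotypicMatrix b n lam with hQ₂
  set Q₃ : Matrix (Word c n) (Word c n) ℂ := ∑ lam ∈ B₃, wordIsotypicMatrix c n lam with hQ₃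
  set Q₁' : Matrix (Word a n) (Word a n) ℂ := ∑ lam ∈ B₁ᶜ, wordIsotypicMatrix a n lam with hQ₁'
  set Q₂' : Matrix (Word b n) (Word b n) ℂ := ∑ lam ∈ B₂ᶜ, wordIsotypicMatrix b n lam with hQ₂'
  set Q₃' : Matrix (Word c n) (Word c n) ℂ := ∑ lam ∈ B₃ᶜ, wordIsotypicMatrix c n lam with hQ₃'
  have hQ₁h : Q₁.IsHermitian := isHermitian_sum_wordIsotypicMatrix B₁
  have hQ₂h : Q₂.IsHermitian := isHermitian_sum_wordIsotypicMatrix B₂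
  have hQ₃h : Q₃.IsHermitian := isHermitian_sum_wordIsotypicMatrix B₃
  have hQ₁e : Q₁ * Q₁ = Q₁ := sum_wordIsotypicMatrix_mul_sum_self B₁
  have hQ₂e : Q₂ * Q₂ = Q₂ := sum_wordIsotypicMatrix_mul_sum_self B₂
  have hQ₃e : Q₃ * Q₃ = Q₃ := sum_wordIsotypicMatrix_mul_sum_self B₃
  have hQ₁i : ∀ v, Q₁ *ᵥ v ∈ commutantSpan (Fin a) (L₁ n) := fun v =>
    sum_wordIsotypicMatrix_mulVec_mem_commutantSpan_entropy B₁
      (fun lam hlam => (Finset.mem_filter.1 hlam).2) v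
  have hQ₂i : ∀ v, Q₂ *ᵥ v ∈ commutantSpan (Fin b) (L₂ n) := fun v =>
    sum_wordIsotypicMatrix_mulVec_mem_commutantSpan_entropy B₂
      (fun lam hlam => (Finset.mem_filter.1 hlam).2) v
  have hQ₃i : ∀ v, Q₃ *ᵥ v ∈ commutantSpan (Fin c) (L₃ n) := fun v =>
    sum_wordIsotypicMatrix_mulVec_mem_commutantSpan_entropy B₃
      (fun lam hlam => (Finset.mem_filter.1 hlam).2) v
  have hQQ₁ : Q₁ + Q₁' = 1 := sum_wordIsotypicMatrix_add_sum_compl B₁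
  have hQQ₂ : Q₂ + Q₂' = 1 := sum_wordIsotypicMatrix_add_sum_compl B₂
  have hQQ₃ : Q₃ + Q₃' = 1 := sum_wordIsotypicMatrix_add_sum_compl B₃
  have kl₁ := hn₁ n hnn₁ Q₁ hQ₁h hQ₁e hQ₁i
  have kl₂ := hn₂ n hnn₂ Q₂ hQ₂h hQ₂e hQ₂i
  have kl₃ := hn₃ n hnn₃ Q₃ hQ₃h hQ₃e hQ₃i
  -- the tensor power and its four pieces
  set X := kroneckerPow x n with hXdef
  set X₁ := actTensor Q₁ (1 : Matrix (Word b n) (Word b n) ℂ) (1 : Matrix (Word c n) (Word c n) ℂ) X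
    with hX₁
  set X₂ := actTensor Q₁' Q₂ (1 : Matrix (Word c n) (Word c n) ℂ) X with hX₂
  set X₃ := actTensor Q₁' Q₂' Q₃ X with hX₃
  set X₄ := actTensor Q₁' Q₂' Q₃' X with hX₄
  have hsplit : X = X₁ + X₂ + X₃ + X₄ := by
    have e1 : X = X₁ + actTensor Q₁' (1 : Matrix (Word b n) (Word b n) ℂ)
        (1 : Matrix (Word c n) (Word c n) ℂ) X := by
      rw [hX₁, ← actTensor_add_fst, hQQ₁, actTensor_one]
    have e2 : actTensor Q₁' (1 : Matrix (Word b n) (Word b n) ℂ) (1 : Matrix (Word c n) (Word c n) ℂ) X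
        = X₂ + actTensor Q₁' Q₂' (1 : Matrix (Word c n) (Word c n) ℂ) X := by
      rw [hX₂, ← actTensor_add_snd, hQQ₂]
    have e3 : actTensor Q₁' Q₂' (1 : Matrix (Word c n) (Word c n) ℂ) X = X₃ + X₄ := by
      rw [hX₃, hX₄, ← actTensor_add_thd, hQQ₃]
    rw [e1, e2, e3]
    abel
  -- the good part does not vanish
  have hX₄ne : X₄ ≠ 0 := by
    intro h0
    have hX3 : X = X₁ + X₂ + X₃ := by rw [hsplit, h0, add_zero]
    have f₁ : actTensor Q₁ (1 : Matrix (Word b n) (Word b n) ℂ) (1 : Matrix (Word c n) (Word c n) ℂ) X₁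
        = X₁ := by
      rw [hX₁, actTensor_actTensor, hQ₁e, Matrix.mul_one, Matrix.mul_one]
    have f₂ : actTensor (1 : Matrix (Word a n) (Word a n) ℂ) Q₂ (1 : Matrix (Word c n) (Word c n) ℂ) X₂
        = X₂ := by
      rw [hX₂, actTensor_actTensor, hQ₂e, Matrix.one_mul, Matrix.mul_one]
    have f₃ : actTensor (1 : Matrix (Word a n) (Word a n) ℂ) (1 : Matrix (Word b n) (Word b n) ℂ) Q₃ X₃
        = X₃ := by
      rw [hX₃, actTensor_actTensor, hQ₃e, Matrix.one_mul, Matrix.one_mul]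
    have hub := tensorNormSq_le_sum_three_legs hQ₁h hQ₂h hQ₃h hQ₁e hQ₂e hQ₃e hX3 f₁ f₂ f₃
    rw [hXdef, tensorNormSq_kroneckerPow, reducedDensity₁_kroneckerPow, reducedDensity₂_kroneckerPow,
      reducedDensity₃_kroneckerPow] at hub
    have hNn : 0 < N ^ n := pow_pos hN n
    linarith
  -- hence a good triple of isotypic projectors does not kill `X`
  have hX₄sum : X₄ = ∑ lam ∈ B₁ᶜ, ∑ mu ∈ B₂ᶜ, ∑ nu ∈ B₃ᶜ,
      actTensor (wordIsotypicMatrix a n lam) (wordIsotypicMatrix b n mu) (wordIsotypicMatrix c n nu) X := by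
    rw [hX₄, hQ₁', actTensor_sum_fst]
    refine Finset.sum_congr rfl fun lam _ => ?_
    rw [hQ₂', actTensor_sum_snd]
    refine Finset.sum_congr rfl fun mu _ => ?_
    rw [hQ₃', actTensor_sum_thd]
  rw [hX₄sum] at hX₄ne
  obtain ⟨lam, hlam, h1⟩ := Finset.exists_ne_zero_of_sum_ne_zero hX₄ne
  obtain ⟨mu, hmu, h2⟩ := Finset.exists_ne_zero_of_sum_ne_zero h1
  obtain ⟨nu, hnu, h3⟩ := Finset.exists_ne_zero_of_sum_ne_zero h2
  have hlam' : c₁ - ε < partitionEntropy lam := by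
    have : lam ∉ B₁ := Finset.mem_compl.1 hlam
    rw [hB₁, Finset.mem_filter, not_and] at this
    exact not_le.1 (this (Finset.mem_univ _))
  have hmu' : c₂ - ε < partitionEntropy mu := by
    have : mu ∉ B₂ := Finset.mem_compl.1 hmu
    rw [hB₂, Finset.mem_filter, not_and] at this
    exact not_le.1 (this (Finset.mem_univ _))
  have hnu' : c₃ - ε < partitionEntropy nu := by
    have : nu ∉ B₃ := Finset.mem_compl.1 hnu
    rw [hB₃, Finset.mem_filter, not_and] at this
    exact not_le.1 (this (Finset.mem_univ _))
  refine ⟨n, ![lam, mu, nu], hnpos, ?_, ?_⟩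
  · exact upperAdmissible_of_actTensor_wordIsotypicMatrix_ne_zero θ h3
  · have hθ0 := hθ.1 0
    have hθ1 := hθ.1 1
    have hθ2 := hθ.1 2
    have hsum : θ 0 + θ 1 + θ 2 = 1 := by
      have h := hθ.2
      rw [Fin.sum_univ_three] at h
      exact h
    have i0 : θ 0 * (c₁ - ε) ≤ θ 0 * partitionEntropy lam := mul_le_mul_of_nonneg_left hlam'.le hθ0
    have i1 : θ 1 * (c₂ - ε) ≤ θ 1 * partitionEntropy mu := mul_le_mul_of_nonneg_left hmu'.le hθ1
    have i2 : θ 2 * (c₃ - ε) ≤ θ 2 * partitionEntropy nu := mul_le_mul_of_nonneg_left hnu'.le hθ2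
    have hw : weightedPartitionEntropy θ ![lam, mu, nu] =
        θ 0 * partitionEntropy lam + θ 1 * partitionEntropy mu + θ 2 * partitionEntropy nu := rfl
    rw [hw, hq]
    nlinarith

/-- `H_θ(x) ≤ E^θ(x)` on alphabets `Fin a, Fin b, Fin c`. [cite: ChristandlVranaZuiddam2023, Thm. 3.24] -/
theorem quantumEntropy_le_upperLogQuantumFunctional_fin {a b c : ℕ} {θ : Fin 3 → ℝ}
    (hθ : θ ∈ stdSimplex ℝ (Fin 3)) (x : Fin a → Fin b → Fin c → ℂ) :
    quantumEntropy θ x ≤ upperLogQuantumFunctional θ x := by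
  by_cases hx : x = 0
  · subst hx
    rw [quantumEntropy_zero, upperLogQuantumFunctional_zero]
  refine le_of_forall_pos_le_add fun ε hε => ?_
  obtain ⟨n, lam, hn, hadm, hval⟩ := exists_upperAdmissible_fin hθ hx hε
  have h := weightedPartitionEntropy_le_upperLogQuantumFunctional schurWeyl_isotypicSum_eq_zero_holds
    hθ.1 hn hadm
  linarith

end Core

/-! ## Re-indexing to `Fin` alphabets and the general statements -/

section Transport

universe u v

variable {ι κ μ : Type u} [Fintype ι] [Fintype κ] [Fintype μ] [DecidableEq ι] [DecidableEq κ]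
  [DecidableEq μ]

/-- The relabelling matrix `E_e = (δ_{e⁻¹ i, x})` of a bijection `e : ι ≃ Fin a` is an isometry:
`E_eᴴ E_e = 1`. [folklore] -/
theorem conjTranspose_relabel_mul_self {a : ℕ} (e : ι ≃ Fin a) :
    ((1 : Matrix ι ι ℂ).submatrix (⇑e.symm) id)ᴴ *
      (1 : Matrix ι ι ℂ).submatrix (⇑e.symm) id = 1 := by
  rw [Matrix.conjTranspose_submatrix, Matrix.conjTranspose_one, Matrix.submatrix_mul_equiv,
    Matrix.mul_one, Matrix.submatrix_id_id]

/-- Entries of a relabelled tensor: `((E₁ ⊗ E₂ ⊗ E₃)·t)(i, j, k) = t(e₁⁻¹ i, e₂⁻¹ j, e₃⁻¹ k)`.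
[folklore] -/
theorem actTensor_relabel_apply {a b c : ℕ} (e₁ : ι ≃ Fin a) (e₂ : κ ≃ Fin b) (e₃ : μ ≃ Fin c)
    (t : ι → κ → μ → ℂ) (i : Fin a) (j : Fin b) (k : Fin c) :
    actTensor ((1 : Matrix ι ι ℂ).submatrix (⇑e₁.symm) id)
      ((1 : Matrix κ κ ℂ).submatrix (⇑e₂.symm) id)
      ((1 : Matrix μ μ ℂ).submatrix (⇑e₃.symm) id) t i j k =
      t (e₁.symm i) (e₂.symm j) (e₃.symm k) := by
  have hA : ∀ (i : Fin a) (w : ι), ((1 : Matrix ι ι ℂ).submatrix (⇑e₁.symm) id) i w =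
      (1 : Matrix ι ι ℂ) (e₁.symm i) w := fun _ _ => rfl
  have hB : ∀ (j : Fin b) (y : κ), ((1 : Matrix κ κ ℂ).submatrix (⇑e₂.symm) id) j y =
      (1 : Matrix κ κ ℂ) (e₂.symm j) y := fun _ _ => rfl
  have hC : ∀ (k : Fin c) (z : μ), ((1 : Matrix μ μ ℂ).submatrix (⇑e₃.symm) id) k z =
      (1 : Matrix μ μ ℂ) (e₃.symm k) z := fun _ _ => rfl
  simp only [actTensor_apply, hA, hB, hC]
  rw [Finset.sum_eq_single_of_mem (e₁.symm i) (Finset.mem_univ _)]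
  · rw [Finset.sum_eq_single_of_mem (e₂.symm j) (Finset.mem_univ _)]
    · rw [Finset.sum_eq_single_of_mem (e₃.symm k) (Finset.mem_univ _)]
      · simp only [Matrix.one_apply_eq, one_mul]
      · intro z _ hz
        rw [Matrix.one_apply_ne (Ne.symm hz), mul_zero, zero_mul]
    · intro y _ hy
      simp only [Matrix.one_apply_ne (Ne.symm hy), mul_zero, zero_mul, Finset.sum_const_zero]
  · intro w _ hw
    simp only [Matrix.one_apply_ne (Ne.symm hw), zero_mul, Finset.sum_const_zero]

/-- Tensor powers of a relabelled tensor are the re-indexed tensor powers (`reindexPow`).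
[folklore] -/
theorem kroneckerPow_actTensor_relabel {a b c : ℕ} (e₁ : ι ≃ Fin a) (e₂ : κ ≃ Fin b) (e₃ : μ ≃ Fin c)
    (t : ι → κ → μ → ℂ) (n : ℕ) :
    kroneckerPow (actTensor ((1 : Matrix ι ι ℂ).submatrix (⇑e₁.symm) id)
      ((1 : Matrix κ κ ℂ).submatrix (⇑e₂.symm) id)
      ((1 : Matrix μ μ ℂ).submatrix (⇑e₃.symm) id) t) n =
      reindexPow e₁ e₂ e₃ (kroneckerPow t n) := by
  funext u v w
  simp only [kroneckerPow_apply, reindexPow_apply, actTensor_relabel_apply, Function.comp_apply]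

omit [Fintype ι] [Fintype κ] [Fintype μ] [DecidableEq ι] [DecidableEq κ] [DecidableEq μ] in
/-- The operator of Def. 3.3 commutes with re-indexing of the alphabets. [folklore] -/
theorem upperProjection_reindexPow {ι₀ κ₀ μ₀ : Type v} (eι : ι ≃ ι₀) (eκ : κ ≃ κ₀) (eμ : μ ≃ μ₀)
    (θ : Fin 3 → ℝ) {n : ℕ} (lam : Fin 3 → Nat.Partition n)
    (u : (Fin n → ι) → (Fin n → κ) → (Fin n → μ) → ℂ) :
    upperProjection θ lam (reindexPow eι eκ eμ u) = reindexPow eι eκ eμ (upperProjection θ lam u) := by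
  classical
  simp only [upperProjection]
  split_ifs <;>
    simp only [reindexPow_isotypicSum₁, reindexPow_isotypicSum₂, reindexPow_isotypicSum₃]

/-- **Admissibility is invariant under relabelling the bases.** [cite: ChristandlVranaZuiddam2023, Def. 3.3] -/
theorem upperAdmissible_actTensor_relabel_iff {a b c : ℕ} (e₁ : ι ≃ Fin a) (e₂ : κ ≃ Fin b)
    (e₃ : μ ≃ Fin c) (θ : Fin 3 → ℝ) (t : ι → κ → μ → ℂ) {n : ℕ} (lam : Fin 3 → Nat.Partition n) :
    UpperAdmissible θ (actTensor ((1 : Matrix ι ι ℂ).submatrix (⇑e₁.symm) id)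
      ((1 : Matrix κ κ ℂ).submatrix (⇑e₂.symm) id)
      ((1 : Matrix μ μ ℂ).submatrix (⇑e₃.symm) id) t) n lam ↔
      UpperAdmissible θ t n lam := by
  unfold UpperAdmissible
  rw [kroneckerPow_actTensor_relabel, upperProjection_reindexPow, reindexPow_ne_zero_iff]

/-- `H_θ` is invariant under relabelling the bases (the relabelling matrices are isometries,
CVZ Rem. 3.17). [cite: ChristandlVranaZuiddam2023, Rem. 3.17] -/
theorem quantumEntropy_actTensor_relabel {a b c : ℕ} (e₁ : ι ≃ Fin a) (e₂ : κ ≃ Fin b)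
    (e₃ : μ ≃ Fin c) (θ : Fin 3 → ℝ) (t : ι → κ → μ → ℂ) :
    quantumEntropy θ (actTensor ((1 : Matrix ι ι ℂ).submatrix (⇑e₁.symm) id)
      ((1 : Matrix κ κ ℂ).submatrix (⇑e₂.symm) id)
      ((1 : Matrix μ μ ℂ).submatrix (⇑e₃.symm) id) t) = quantumEntropy θ t := by
  have h₁ : ((1 : Matrix ι ι ℂ).submatrix (⇑e₁.symm) id)ᴴ *
      (1 : Matrix ι ι ℂ).submatrix (⇑e₁.symm) id = (1 : Matrix ι ι ℂ)ᴴ * 1 := by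
    rw [conjTranspose_relabel_mul_self, Matrix.conjTranspose_one, Matrix.mul_one]
  have h₂ : ((1 : Matrix κ κ ℂ).submatrix (⇑e₂.symm) id)ᴴ *
      (1 : Matrix κ κ ℂ).submatrix (⇑e₂.symm) id = (1 : Matrix κ κ ℂ)ᴴ * 1 := by
    rw [conjTranspose_relabel_mul_self, Matrix.conjTranspose_one, Matrix.mul_one]
  have h₃ : ((1 : Matrix μ μ ℂ).submatrix (⇑e₃.symm) id)ᴴ *
      (1 : Matrix μ μ ℂ).submatrix (⇑e₃.symm) id = (1 : Matrix μ μ ℂ)ᴴ * 1 := by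
    rw [conjTranspose_relabel_mul_self, Matrix.conjTranspose_one, Matrix.mul_one]
  rw [quantumEntropy_actTensor_eq_of_gram_eq θ t h₁ h₂ h₃, actTensor_one]

/-- **An admissible triple of entropy at least `H_θ(x) - ε`** for every nonzero complex 3-tensor `x`
on finite index types, `θ ∈ P([3])`, `ε > 0`. [cite: ChristandlVranaZuiddam2023, Thm. 3.24] -/
theorem exists_upperAdmissible {θ : Fin 3 → ℝ} (hθ : θ ∈ stdSimplex ℝ (Fin 3)) {x : ι → κ → μ → ℂ}
    (hx : x ≠ 0) {ε : ℝ} (hε : 0 < ε) :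
    ∃ (n : ℕ) (lam : Fin 3 → Nat.Partition n), 0 < n ∧ UpperAdmissible θ x n lam ∧
      quantumEntropy θ x - ε ≤ weightedPartitionEntropy θ lam := by
  set e₁ := Fintype.equivFin ι
  set e₂ := Fintype.equivFin κ
  set e₃ := Fintype.equivFin μ
  set x' := actTensor ((1 : Matrix ι ι ℂ).submatrix (⇑e₁.symm) id)
      ((1 : Matrix κ κ ℂ).submatrix (⇑e₂.symm) id)
      ((1 : Matrix μ μ ℂ).submatrix (⇑e₃.symm) id) x with hx'
  have hx'0 : x' ≠ 0 := by
    intro h0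
    apply hx
    funext i j k
    have h := congrFun (congrFun (congrFun h0 (e₁ i)) (e₂ j)) (e₃ k)
    rw [hx', actTensor_relabel_apply] at h
    simpa using h
  obtain ⟨n, lam, hn, hadm, hval⟩ := exists_upperAdmissible_fin hθ hx'0 hε
  refine ⟨n, lam, hn, (upperAdmissible_actTensor_relabel_iff e₁ e₂ e₃ θ x lam).1 hadm, ?_⟩
  rwa [hx', quantumEntropy_actTensor_relabel] at hval

/-- **`H_θ(x) ≤ E^θ(x)`** for every complex 3-tensor on finite index types and `θ ∈ P([3])`
(CVZ, proof of Thm. 3.24: "`E^θ(t) ≥ ∑ θ(b) H(λ̄^{(b)}) ≥ ∑ θ(b) H(r_b) - δ(ε)`").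
[cite: ChristandlVranaZuiddam2023, Thm. 3.24] -/
theorem quantumEntropy_le_upperLogQuantumFunctional {θ : Fin 3 → ℝ} (hθ : θ ∈ stdSimplex ℝ (Fin 3))
    (x : ι → κ → μ → ℂ) : quantumEntropy θ x ≤ upperLogQuantumFunctional θ x := by
  by_cases hx : x = 0
  · subst hx
    rw [quantumEntropy_zero, upperLogQuantumFunctional_zero]
  refine le_of_forall_pos_le_add fun ε hε => ?_
  obtain ⟨n, lam, hn, hadm, hval⟩ := exists_upperAdmissible hθ hx hε
  have h := weightedPartitionEntropy_le_upperLogQuantumFunctional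
    schurWeyl_isotypicSum_eq_zero_holds.{u} hθ.1 hn hadm
  linarith

/-- **CVZ Theorem 3.24: `E_θ(t) ≤ E^θ(t)`** — the logarithmic upper quantum functional of Def. 3.3
dominates the (lower) logarithmic quantum functional of Def. 3.16, for every `θ ∈ P([3])` and every
complex 3-tensor `t` on finite index types: each `H_θ(g·t) ≤ E^θ(g·t) = E^θ(t)` (`GL`-invariance,
Lemma 3.6). [cite: ChristandlVranaZuiddam2023, Thm. 3.24] -/
theorem logQuantumFunctional_le_upperLogQuantumFunctional {θ : Fin 3 → ℝ}
    (hθ : θ ∈ stdSimplex ℝ (Fin 3)) (t : ι → κ → μ → ℂ) :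
    logQuantumFunctional θ t ≤ upperLogQuantumFunctional θ t :=
  ciSup_le fun _ => (quantumEntropy_le_upperLogQuantumFunctional hθ _).trans
    (upperLogQuantumFunctional_actTensor_le schurWeyl_isotypicSum_eq_zero_holds.{u} hθ.1 _ _ _ t)

end Transport

end Literature.Computability.AlgebraicComplexity

end
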